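import Mathlib
import HarnessLib
import HarnessLib.Audit
import Summits.QuantumAdvantage.Statement
import Literature.Computability.QuantumComplexity.Forrelation
import Literature.Computability.Complexity.DecisionTree
import Literature.Computability.Complexity.ProbabilisticClasses
import HarnessLib.Audit.Status.Attr

/-!
Route: HiddenSpread

DORMANT since 2026-08-23T03:26:08Z (reconciler: no traction for 5.8 d (last activity item-evidence-added at 2026-08-17T06:06:21Z); parked, not closed — `ledger route dormant route-QuantumAdvantage-HiddenSpread --off` to reactivate) — unstaffed, not closed; items shared with open routes are served there. `ledger route dormant <id> --off` reactivates.

# Route QuantumAdvantage/HiddenSpread — certified hidden-spread Forrelation (idea card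
`hidden-spread-forrelation`)

## Thesis X ("it suffices to show X")
Words: there is a polynomial-time CERTIFIABLE family of explicit 2-fold Forrelation instances — a
set S ∈ P of inputs and an
extractor π ∈ FP such that every x ∈ S carries a pair of B₂-circuits (C₀, C₁) on 2m bits computing a
HIDDEN-SPREAD PAIR
(f, g) = (b(x/y)∘e⁻¹, f̃ ⊕ ⟨t,·⟩): b a balanced Boolean function on 𝔽_{2^m} with b(0)=0, e a secret
𝔽₂-linear
parametrisation 𝔽_{2^m}² ≃ 𝔽₂^{2m} (Dillon's partial-spread bent function PS_ap, twisted), f̃ its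
Walsh dual (again of PS_ap
form, b(y/x)∘e^†), t ∈ 𝔽₂^{2m} a secret mask — together with two input ensembles D₀ (mask t = 0) and
D₁ (t ≠ 0) supported on S
that are computationally indistinguishable for probabilistic polynomial time.
Lean: `HiddenSpreadWitness` (this file; one-line Prop over `Classes.P`, `FP`,
`KForrelationInstance.encode`, `Circuit.eval`,
`GaloisField 2 m`, `RandAlg.IsPolyTime`/`RandAlg.outputPMF`/`PMF`; the indistinguishability clause
is the tree notion
`Cryptography.IsCompIndistinguishable D₀ D₁` with `Ensemble`, `distAdvantage`, `acceptPMF`, `IsPPT`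
UNFOLDED VERBATIM — definitionally
equal, `Iff.rfl` checked (route-repair 2026-08-15) — so that the route file does not import
`Cryptography.Indistinguishability`, whose
unused open conjectures `PRGExist`/`OWFExist`/… would otherwise sit in the import cone).

## Assembly (X → Statement) = the PROVED deciding theorem `closes` of this file (D-0027 §2.1)
`closes : HiddenSpreadWitness → ExactForrelation → CertifiedForrelationInBQP →
IndistinguishableNotInBPP → QuantumAdvantage` (sorry-free,
axioms propext/Classical.choice/Quot.sound; the `Assembly` item is the same implication re-ordered
and is discharged by
`fun hC hI hE hW => closes hW hE hC hI`; SpreadShiftQueryLB and SpreadDuality are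
evidence/instantiation items, not premises), with the witness language L = {x ∈ S | π x ∈
kForrelationProblem.yes}:
* ExactForrelation (support; Dutta–Maitra–Mukherjee 2022 Prop 1–3): Φ(f, f̃ ⊕ ⟨t,·⟩) = [t = 0]
EXACTLY, so certified
  instances land in the yes (Φ = 1 ≥ 3/5) or no (Φ = 0) part of the tree's `kForrelationProblem`;
* CertifiedForrelationInBQP (support; glue over the PROVED
`AaronsonAmbainis2018_kForrelation_mem_holds`,
  `mem_PromiseBQP_of_polyTimeReducible`, `ofLanguage_mem_PromiseBQP_iff`): a P-certified sub-promise
of explicit Forrelation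
  is a BQP LANGUAGE (certification replaces the promise; no promise→language lift `PlLift` is
needed);
* IndistinguishableNotInBPP (support; over the PROVED `mem_BPP_iff_randAlg_holds`): a BPP decider is
a distinguisher;
* hence ∃ L ∈ BQP ∖ BPP = `QuantumAdvantage`.
The quantum side is Rötteler's exact 2-query hidden-shift circuit for bent functions with dual
access (the pair (f, f̃⊕⟨t,·⟩) is
(h(·+t), h̃) in disguise), run white-box by the tree's proved Forrelation family; L is even in EQP.

CONDITIONAL BRIDGE in substance: HiddenSpreadWitness (crux, rank 2) is hypothesis-type — a new
"classically hard, quantumly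
easy" assumption that is NOT number-theoretic/HSP-based; the route's provable content is the bridge,
the exactness/duality
algebra, and the black-box evidence `SpreadShiftQueryLB` (crux, rank 3).

Rationale: WHY THIS LINE. Every decision-level route to the summit in the tree is number theory (Shor,
AvgCase/DLOG, CircuitLB/FACT) or a
reformulation (PromiseLift). The card imports CODING THEORY (Dillon 1974 partial-spread bent
functions and their explicit duals,
Roetteler2010 Thm 5–6, Carlet2010 §8.6, DuttaMaitraMukherjee2022 §3) and OBFUSCATION-ERA
cryptography (BitanskyPanethRosen2015's
"obfuscate the oracle separation" paradigm; AaronsonChen2017 Thm 7.6/8.1) to get a candidate BQP∖BPP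
LANGUAGE whose quantum
algorithm is EXACT and whose hardness is correlational (Forrelation), not a period/collision. Two
facts found while planning shape
the route: (i) Roetteler2010 Thm 8 — with dual access but WITHOUT a secret linear twist,
Maiorana–McFarland hidden shift is
classically Θ(n); untwisted PS_ap is equally easy (query h(·+t) on a known spread line) — so the
secret GL_{2m}(𝔽₂) twist e is
load-bearing; (ii) a standard (quantizable, black-box) security reduction can never derive the
hardness from QUANTUM-SECURE
iO/OWF (Rötteler's exact quantum solver plugged into the reduction would break the post-quantum
primitive), so the hardness is a
free-standing assumption exactly like `FACT ∉ BPP` in route Shor, provable only in the black-box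
model (= crux SpreadShiftQueryLB).
Numerics: py/check_duality.py (planner folder) verifies for m = 2, 3 and random e that f is bent,
its dot-product dual is
b(v/u)∘e^† and Φ(f, f̃⊕⟨t,·⟩) = [t=0] exactly.

RANKED CRUXES.
2. HiddenSpreadWitness (typed; = X). Hypothesis-type; refutable by a classical attack on twisted
PS_ap pairs from ANY circuit
   representation, or by showing certification (S ∈ P, perfectly sound) cannot hide the mask bit.
3. SpreadShiftQueryLB (typed). R_{1/3} of the black-box twisted-PS_ap mask decision ≥ c·2^{m/2}: the
theorem that makes the
   assumption consistent (oracle-HSF), by a Simon/Roetteler-Thm-9-style bad-event argument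
(collisions of hidden spread classes,
   probability O(q²/2^m); conditioned on no collision the transcript is exchangeable balanced bits
independent of e and t).
4. ObfuscatedSpreadInstantiation (support since retriage; informal — the requested definitions
`IndistinguishabilityObfuscator`,
   `OneMessageProofSystem` have landed, but typing it over them would re-import
`Cryptography.Indistinguishability` and its unused
   PRG/OWF conjectures into the cone: type it once those conjectures live in their own file, with
the strong-WI clause): PRP-keyed b, perfectly correct iO,
   a perfectly sound one-message proof of well-formedness; HSF⁺ (indistinguishability of the
certified packages) → X. NIWI alone is
   vacuous for this unique-witness relation (hiding needs NIWH à la KuykendallZhandry2020 or is part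
of HSF⁺) — flagged openly.
SUPPORT (rank 9): ExactForrelation, SpreadDuality (dual of twisted PS_ap is twisted PS_ap:
efficiency of g), CertifiedForrelationInBQP,
IndistinguishableNotInBPP (candidate proofs attached as item evidence for 2455/2457; 2456 =
transport of the Literature fact
`Dillon1974_PSap_walsh_dual` along e). The X → Statement glue is the proved `closes` theorem of the
route file; the Assembly item (2459) is the same implication and is
discharged by the one-liner `fun hC hI hE hW => closes hW hE hC hI` (provers: land that). Foreseen
later (not filed): PRP ⇒ pseudorandomness of the keyed pair-oracle family (computational form of
crux 3, AC17 Thm 7.6-style); BQP-decidable (instead of P) certification guard.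

KILL CRITERIA. ¬SpreadShiftQueryLB with a poly(m)-query classical algorithm (black-box attack ⇒
white-box attack) closes the route;
a proof that no S ∈ P can certify hidden-spread structure while hiding t (e.g. t is FP-computable
from any certifying encoding)
refutes HiddenSpreadWitness; ExactForrelation/SpreadDuality failing as typed = convention slip →
restate, not close.

NOT DECOMPOSED YET. The iO/NIWH formalisation (definition requests filed), the PRP-keyed
computational oracle theorem, amplification
details inside CertifiedForrelationInBQP, Maiorana–McFarland as alternative bent family (more linear
structure; Roetteler Thm 8 warns).
Literature hygiene wanted (not a route item): split `PRGExist` and the `OneWayFunctions` import out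
of
`Literature/Computability/Cryptography/Indistinguishability.lean` so that `IsCompIndistinguishable`
is importable debt-free; then items
2453/2458 can be re-folded to the named notion by `Iff.rfl` and 2638 typed. needs-fact: NONE of the
13 cone facts is used by any item.

CHEAPEST FALSIFIER. A poly(m)-query classical algorithm deciding [t = 0] for twisted PS_ap pairs
with dual access (¬SpreadShiftQueryLB) —
first try: extend Roetteler2010 Thm 8's O(m)-query attack from a KNOWN spread line to a secret
𝔽₂-linear twist e (e.g. recover one
spread class from second differences of g', which are t-free); success kills the line outright
(black-box attack ⇒ white-box attack).
NOVELTY and BARRIERS: see the dedicated sections below (D-0021).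

Novelty: NOVELTY (searched 2026-08-15 BEFORE claiming: `lit search --source zbmath` "hidden shift bent",
"indistinguishability obfuscation
quantum advantage", "verifiable quantum advantage without structure"; `lit search --source crossref`
(Roetteler; obfuscation oracle
separation BQP); `lit read arxiv:0811.3208` pp. 8, 10–12 and `lit read arxiv:2104.12212` §3 pp.
9–10; `lit galaxy search "Boolean
hidden shift" --star all` (7 rows: CKOR13, GRR11, Gharibi 2013, ASIACRYPT hidden-shift cryptanalysis
volumes); local searchd and
arXiv/S2/OpenAlex APIs were down/429 — logged in NOTES.md; the card's own searches (AC17 full text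
'obfuscat' = 0, KQT24 p. 8 "no
non-oracular Forrelation-type BQP candidates", Zhandry 1711.02276 §6, BDV21) are inherited).
Nearest prior art and delta:
(1) Roetteler2010 = arXiv:0811.3208: Def 2/Thm 6 (bent hidden shift with dual access: exact 2-query
quantum algorithm) — our quantum
side IS this (the pair (f, f̃⊕⟨t,·⟩) is (h(·+t), h̃)); Thm 5 (Dillon PS); Thm 8: Maiorana–McFarland
WITH dual access is classically
Θ(n) — i.e. the untwisted problem is EASY; Thm 9: without dual access Θ(√2ⁿ). DELTA: the secret
𝔽₂-linear twist of a PS_ap spread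
with dual access, and the claim (crux SpreadShiftQueryLB) that it restores an exponential classical
lower bound — not in print
(ChildsKothariOzolsRoetteler2013 = arXiv:1304.4642 and GavinskyRoettelerRoland2011 = arXiv:1103.3017
treat quantum query complexity /
random functions, no twisted-spread classical bound).
(2) DuttaMaitraMu  [refs: 10.1109/FOCS.2015.94, 0811.3208, 2104.12212, 1304.4642, 1103.3017, 1612.05903, 2204.02063, arxiv:0811.3208, arxiv:2104.12212, doi:10.1109/FOCS.2015.94, Roetteler2010, ChildsKothariOzolsRoetteler2013, GavinskyRoettelerRoland2011, DuttaMaitraMukherjee2022, AaronsonChen2017, BitanskyPanethRosen2015, YamakawaZhandry2022]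

Barriers (technique_class: conditional-bridge, obfuscation, bent-duality, non-black-box): technique_class: conditional-bridge, obfuscation, bent-duality, non-black-box
- Literature.Barriers.QuantumAdvantage.SeparationPrerequisites: APPLIES to the summit and hence to X
= HiddenSpreadWitness (X ⇒ summit ⇒
  PP ⊄ BPP, P ≠ PSPACE via not_PP_subset_BPP_of_witness / P_ne_PSPACE_of_witness); NOT evaded — X is
carried as a hypothesis-type crux
  (conditional bridge in substance), exactly as FACT ∉ BPP in route Shor. The route proves the
bridge and the black-box evidence, not X.
- Literature.Barriers.QuantumAdvantage.PPolyOracles: aaronsonChen2017_thm81 says P/poly-ORACLE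
separations need an unrelativized
  assumption; evaded in kind — there is no oracle: the circuits are part of the INPUT and
certification (S ∈ P) replaces the oracle
  promise; aaronsonChen2017_thm76 (OWF ⇒ P/poly oracle separation) is the oracle shadow of crux 3 +
PRP keying, and the unrelativized
  assumption Thm 8.1 asks for is precisely HiddenSpreadWitness (which cannot follow from
quantum-secure primitives by a quantizable
  reduction — rationale (ii)).
- Literature.Barriers.QuantumAdvantage.TotalFunctionSpeedupLimit: bealsEtAl2001_thm54 (D ≤ 4096·Q₂⁶
for TOTAL functions) — consistent:
  the black-box problem of crux 3 is a PROMISE problem (hidden-spread tables), where exponential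
gaps are allowed (simon_lower /
  raz_tal_forrelation pattern); totality of the LANGUAGE comes from white-box certification, not
from a total black-box function.
- Literature.Barriers.QuantumAdvantage.RandomOracleMethod: aa

Novelty grade: new-combination — NOVELTY (refuter E-d83931e1-g2, 2026-08-15; 4th pass). Searches: zbMATH 'bent function hidden shift' (4), 'Forrelation' (19); S2 'hidden shift problem bent functions classical query complexity' (20, all quantum/query side); arXiv API ×6; galaxy --star all 'hidden shift problem for bent functions' (2 (refuter refuter-rreview-route-QuantumAdvantage-E-d83931e1-g2-0, 2026-08-15T14:31:02Z; prior: arXiv:0811.3208 Roetteler2010 Def 2, Thm 5/6 (quantum side verbatim), Thm 8 (untwisted MM+dual classically easy), Thm 9, doi:10.1109/FOCS.2015.94 BitanskyPanethRosen2015 + arXiv:1612.05903 AaronsonChen2017 Thm 7.6/8.1 ('obfuscate an oracle separation'; unrelativised assumption needed), arXiv:1411.5729 AaronsonAmbainis2018 §6 Prop 6/Thm 25 (explicit k-fold Forrelation PromiseBQP-complete; certifica)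

History (route lifecycle, newest last):
- 2026-08-23T03:26:08Z · DORMANT — reconciler: no traction for 5.8 d (last activity item-evidence-added at 2026-08-17T06:06:21Z); parked, not closed — `ledger route dormant route-QuantumAdvantage (operator:999:2540990)

sub-problem: QuantumAdvantage · status: dormant · opened planner-plancard-QuantumAdvantage-QuantumAdva-d81aff9c-0 2026-08-15T11:04:19Z · rev 9 · ledger route-QuantumAdvantage-HiddenSpread
GENERATED by the gate from the ledger (D-0016/17). Provers cite these decls: `theorem foo : Summit.QuantumAdvantage.QuantumAdvantage.Theses.HiddenSpread.<Decl> := …` in Summits/QuantumAdvantage/QuantumAdvantage/Theorems/<Name>.lean.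
-/

namespace Summit.QuantumAdvantage.QuantumAdvantage.Theses.HiddenSpread

open scoped BigOperators Topology Manifold Classical MeasureTheory ProbabilityTheory Matrix InnerProductSpace ComplexConjugate ContinuousMap
open Filter Set Function TopologicalSpace MeasureTheory

attribute [summit_statement] _root_.QuantumAdvantage

open Literature.QuantumAdvantage

/-- item stmt-QuantumAdvantage-17591 · crux · rank 2 · open · by planner
why it might fail: Unpublished Ω(2^{m/2})-type bound: conditioning on the random frame e must survive f/g sharing b (cross collisions α(w)=β(u)) and the forced zeros on e(E₀∪E∞); any 𝔽₂-relation among ≤ q queried points visible without a class collision breaks it (untwisted: O(m) queries, Roetteler2010 Thm 8).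
sources: Roetteler2010, arXiv:0811.3208, Simon1997, AaronsonAmbainis2018, ChildsKothariOzolsRoetteler2013
[crux] IDEAL BLACK-BOX BOUND (theorem-type piece of the real/ideal redirect of HiddenSpreadWitness;
the ADVANTAGE form of the route's evidence crux SpreadShiftQueryLB, which it implies by Yao).
Secrets σ = (b, e, g, t): b balanced on 𝔽_{2^m} with b 0 = 0, e an 𝔽₂-linear frame 𝔽_{2^m}² ≃
𝔽₂^{2m}, g the Walsh dual of the twisted PS_ap function f = b(x/y)∘e⁻¹, t ∈ 𝔽₂^{2m} the mask; the
pair table (f, g ⊕ ⟨t,·⟩) is read through any bijection ι. CLAIM: ∃ c > 0, ∀ m ≥ 2, every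
deterministic decision tree of depth ≤ q has multiplicity-weighted acceptance frequencies on the
classes t = 0 and t ≠ 0 differing by ≤ c (q+1)²/√2^m. Pure query complexity (implies nothing about
BPP). Skeleton: pseudo-uniformity of the unmasked table w.r.t. the reference law with the two origin
zeros (bad events: two queries in one hidden spread class / degenerate class, O(q²/2^m) under the
random frame; urn-vs-iid for balanced b) + mask symmetry (t ≠ 0 class = XOR-relabelled t = 0 class).
WHY IT MIGHT FAIL: Unpublished Ω(2^{m/2})-type bound: conditioning on the random frame e must
survive f/g sharing b (cross collisions α(w)=β(u)) and the forced zeros on e(E₀∪E∞); any 𝔽₂-relation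
among ≤ q queried points visible -/
@[route_item "route-QuantumAdvantage-HiddenSpread"]
def SpreadIdealQueryBound : Prop :=
  ∃ c : ℝ, 0 < c ∧ ∀ m : ℕ, 2 ≤ m → ∀ (ι : Bool × (Fin (2 * m) → Bool) ≃ Fin (2 * 2 ^ (2 * m))) (T : Literature.Computability.Complexity.DecisionTree (2 * 2 ^ (2 * m))) (q : ℕ), T.depth ≤ q → (let wt : ((Fin (2 * m) → Bool) → Prop) → (Fin (2 * 2 ^ (2 * m)) → Bool) → ℝ := fun (M : (Fin (2 * m) → Bool) → Prop) (tbl : Fin (2 * 2 ^ (2 * m)) → Bool) => (Nat.card {σ : (GaloisField 2 m → Bool) × ((GaloisField 2 m × GaloisField 2 m) ≃ₗ[ZMod 2] (Fin (2 * m) → ZMod 2)) × ((Fin (2 * m) → Bool) → Bool) × (Fin (2 * m) → Bool) // ((Nat.card {a : GaloisField 2 m // σ.1 a = true} = 2 ^ (m - 1) ∧ σ.1 0 = false) ∧ (∀ u : Fin (2 * m) → Bool, ∑ w : Fin (2 * m) → Bool, Literature.Computability.QuantumComplexity.signOf ((fun w : Fin (2 * m) → Bool => σ.1 ((σ.2.1.symm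 (fun i => if w i then (1 : ZMod 2) else 0)).1 * (σ.2.1.symm (fun i => if w i then (1 : ZMod 2) else 0)).2 ^ (2 ^ m - 2))) w) * Literature.Computability.QuantumComplexity.twist u w = (2 : ℝ) ^ m * Literature.Computability.QuantumComplexity.signOf (σ.2.2.1 u))) ∧ M σ.2.2.2 ∧ tbl = (fun k : Fin (2 * 2 ^ (2 * m)) => if (ι.symm k).1 then xor (σ.2.2.1 (ι.symm k).2) (Nat.bodd (Finset.univ.filter fun i => σ.2.2.2 i && (ι.symm k).2 i).card) else σ.1 ((σ.2.1.symm (fun i => if (ι.symm k).2 i then (1 : ZMod 2) else 0)).1 * (σ.2.1.symm (fun i => if (ι.symm k).2 i then (1 : ZMod 2) else 0)).2 ^ (2 ^ m - 2)))} : ℝ); let acc : ((Fin (2 * m) → Bool) → Prop) → ℝ := fun (M : (Fin (2 * m) → Bool) → Prop) => (∑ tbl : Fin (2 * 2 ^ (2 * m)) → Bool, wt M tbl * (if T.eval tbl = true then (1 : ℝ) else 0)) / (∑ tbl : Fin (2 * 2 ^ (2 * m)) → Bool, wt M tbl); |acc (fun t => t = fun _ => false) - acc (fun t => t ≠ fun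 _ => false)| ≤ c * ((q : ℝ) + 1) ^ 2 / Real.sqrt 2 ^ m)

/-- item stmt-QuantumAdvantage-2453 · crux · rank 2 · open · by planner
why it might fail: =X ⇒ BQP⊄BPP ⇒ PP⊄BPP. May be FALSE: (a) t P-computable from ANY circuits of a twisted PS_ap pair (untwisted: O(m) queries, Roetteler2010 Thm 8); (b) no S∈P certifies the spread yet hides [t=0]: needs 1-msg no-setup perfectly-sound strong WI — open (Khurana2021 NIDI: arguments; LMS24 WSS: 2 rounds).
sources: Roetteler2010, arXiv:0811.3208, AaronsonChen2017, Khurana2021, LouManoharSahai2024, KuykendallZhandry2020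
Thesis X (hypothesis-type crux; implies the summit via the Assembly). There are S ∈ P (certified
inputs), π ∈ FP (extracting the code of a 2-fold explicit Forrelation instance ⟨2m, 2, (C₀, C₁)⟩
over B₂, m ≥ 2) and a (noncomputable) decomposition dec x = ⟨m, C, t⟩ such that every x ∈ S is a
HIDDEN-SPREAD PAIR: C₀ computes f = b((e⁻¹w).1·(e⁻¹w).2^(2^m−2)) (Dillon PS_ap `b(x/y)`, b balanced
on 𝔽_{2^m} with b 0 = 0, read through a secret 𝔽₂-linear equivalence e), and C₁ computes g ⊕ ⟨t,·⟩
where g is the Walsh dual of f (∑_w (−1)^{f w + u·w} = 2^m (−1)^{g u}); plus ensembles D₀ (supported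
on x ∈ S with t = 0) and D₁ (t ≠ 0) that are computationally indistinguishable (tree
`IsCompIndistinguishable`: negligible advantage for every PPT distinguisher). Candidate witness
(crux ObfuscatedSpreadInstantiation): PRP-keyed b, iO-obfuscated circuits, a perfectly sound
one-message proof of well-formedness as the certificate. NOT derivable from quantum-secure
primitives by a quantizable reduction (Rötteler's exact solver would break them): a free-standing
'classically hard / quantumly easy' assumption, non-number-theoretic. [Roetteler2010 Def 2, Thm 6;
Dillon1974; AaronsonChen2017 Thm 7.6/8.1; Bitan -/
@[route_item "route-QuantumAdvantage-HiddenSpread", crux]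
def HiddenSpreadWitness : Prop :=
  ∃ S : Set (List Bool), S ∈ Literature.Computability.Complexity.Classes.P ∧ ∃ π : List Bool → List Bool, π ∈ Literature.Computability.Complexity.FP ∧ ∃ dec : List Bool → Σ m : ℕ, (Fin 2 → Literature.Computability.Complexity.Circuit (Fin (2 * m))) × (Fin (2 * m) → Bool), (∀ x ∈ S, 2 ≤ (dec x).1 ∧ (∀ i, ((dec x).2.1 i).IsOver Literature.Computability.Complexity.B2) ∧ π x = (⟨2 * (dec x).1, 2, (dec x).2.1⟩ : Literature.Computability.QuantumComplexity.KForrelationInstance).encode ∧ (let m := (dec x).1; (∃ (b : GaloisField 2 m → Bool) (e : (GaloisField 2 m × GaloisField 2 m) ≃ₗ[ZMod 2] (Fin (2 * m) → ZMod 2)) (g : (Fin (2 * m) → Bool) → Bool), (Nat.card {a : GaloisField 2 m // b a = true} = 2 ^ (m - 1) ∧ b 0 = false) ∧ (∀ u : Fin (2 * m) → Bool, ∑ w : Fin (2 * m) → Bool, Literature.Computability.QuantumComplexity.signOf ((fun w : Fin (2 * m) → Bool => b ((e.symm (fun i => if w i then (1 : ZMod 2) else 0)).1 * (e.symm (fun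 i => if w i then (1 : ZMod 2) else 0)).2 ^ (2 ^ m - 2))) w) * Literature.Computability.QuantumComplexity.twist u w = (2 : ℝ) ^ m * Literature.Computability.QuantumComplexity.signOf (g u)) ∧ ((dec x).2.1 0).eval = (fun w : Fin (2 * m) → Bool => b ((e.symm (fun i => if w i then (1 : ZMod 2) else 0)).1 * (e.symm (fun i => if w i then (1 : ZMod 2) else 0)).2 ^ (2 ^ m - 2))) ∧ ((dec x).2.1 1).eval = (fun u : Fin (2 * m) → Bool => xor (g u) (Nat.bodd (Finset.univ.filter fun i => (dec x).2.2 i && u i).card))))) ∧ ∃ D₀ D₁ : ℕ → PMF (List Bool), (∀ A : Literature.Computability.Complexity.RandAlg (List Bool) Bool, A.IsPolyTime id Computability.encodeBool → Asymptotics.SuperpolynomialDecay Filter.atTop (fun n : ℕ => (n : ℝ)) (fun n : ℕ => |(((D₀ n).bind fun s => A.outputPMF id (Literature.Computability.Complexity.boolPair (Computability.unaryEncodeNat n) s)) true).toReal - (((D₁ n).bind fun s => A.outputPMF id (Literature.Computability.Complexity.boolPair (Computability.unaryEncodeNat n) s)) true).toReal|)) ∧ (∀ n, ∀ x ∈ (D₀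 n).support, x ∈ S ∧ (dec x).2.2 = fun _ => false) ∧ (∀ n, ∀ x ∈ (D₁ n).support, x ∈ S ∧ (dec x).2.2 ≠ fun _ => false)

/-- item stmt-QuantumAdvantage-2454 · crux · rank 3 · open · by planner
why it might fail: New Ω(2^{m/2}) bound, unpublished. Untwisted (e known): O(m) queries (Roetteler2010 Thm 8 attack uses just our 2 oracles); known-b variants fall to O(m²)-query Occam tests: hardness needs random b AND secret e. Proof must do adaptivity by conditioning, f/g′ dual-class correlations, f≡0 on e(E₀∪E∞).
sources: Roetteler2010, arXiv:0811.3208, Simon1997, ChildsKothariOzolsRoetteler2013, deWolf2019, AaronsonAmbainis2018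
Black-box shadow of X (the theorem that makes the assumption consistent; Yao + bad events, as
simon_lower_holds). Inputs: tables T : Fin (2·2^{2m}) → Bool of a pair (f, g') indexed through any
bijection ι; P t = tables of hidden-spread pairs with mask t (f = twisted PS_ap for SOME balanced b
with b 0 = 0 and SOME linear equivalence e, g' = (Walsh dual of f) ⊕ ⟨t,·⟩); promise ⋃_t P t; decide
t = 0 (i.e. T ∈ P 0; disjoint from P t, t ≠ 0, by ExactForrelation). CLAIM: ∃ c > 0, ∀ m ≥ 2,
R_{1/3} ≥ c·√(2^m). Proof plan: hard distribution b, e uniform, t = 0 vs t uniform ≠ 0; a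
deterministic q-query tree sees, unless two query points fall in the same hidden spread class
(α(p)=α(p'), β(u)=β(u'), α(p)=β(u), or a degenerate class x=0 / y=0), b evaluated at distinct points
of 𝔽^*_{2^m} (exchangeable balanced bits) ⊕ known masks — a transcript law independent of (e, t);
conditioned on a collision-free history e stays uniform on the good set, so Pr[collision] =
O(q²/2^m) and the advantage is O(q²/2^m) (cross classes V_a ⟂ V_a^⊥ force ⟨p,u⟩ = 0, probability ≈
2^{1−m}). Quantum side for contrast: 2 queries, exact (Roetteler2010 Thm 6). [Roetteler2010 Thm 9
(method, MM without dual); Simon1997; de -/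
@[route_item "route-QuantumAdvantage-HiddenSpread"]
def SpreadShiftQueryLB : Prop :=
  ∃ c : ℝ, 0 < c ∧ ∀ m : ℕ, 2 ≤ m → ∀ ι : Bool × (Fin (2 * m) → Bool) ≃ Fin (2 * 2 ^ (2 * m)), ∀ P : (Fin (2 * m) → Bool) → Set (Fin (2 * 2 ^ (2 * m)) → Bool), (∀ t, P t = {T | ∃ f g' : (Fin (2 * m) → Bool) → Bool, (∃ (b : GaloisField 2 m → Bool) (e : (GaloisField 2 m × GaloisField 2 m) ≃ₗ[ZMod 2] (Fin (2 * m) → ZMod 2)) (g : (Fin (2 * m) → Bool) → Bool), (Nat.card {a : GaloisField 2 m // b a = true} = 2 ^ (m - 1) ∧ b 0 = false) ∧ (∀ u : Fin (2 * m) → Bool, ∑ w : Fin (2 * m) → Bool, Literature.Computability.QuantumComplexity.signOf ((fun w : Fin (2 * m) → Bool => b ((e.symm (fun i => if w i then (1 : ZMod 2) else 0)).1 * (e.symm (fun i => if w i then (1 : ZMod 2) else 0)).2 ^ (2 ^ m - 2))) w) * Literature.Computability.QuantumComplexity.twist u w = (2 : ℝ) ^ m * Literature.Computability.QuantumComplexity.signOf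 (g u)) ∧ f = (fun w : Fin (2 * m) → Bool => b ((e.symm (fun i => if w i then (1 : ZMod 2) else 0)).1 * (e.symm (fun i => if w i then (1 : ZMod 2) else 0)).2 ^ (2 ^ m - 2))) ∧ g' = (fun u : Fin (2 * m) → Bool => xor (g u) (Nat.bodd (Finset.univ.filter fun i => t i && u i).card))) ∧ T = fun k => if (ι.symm k).1 then g' (ι.symm k).2 else f (ι.symm k).2}) → c * Real.sqrt (2 ^ m) ≤ (Literature.Computability.Complexity.randQueryComplexityOn (1 / 3) (⋃ t, P t) (fun T => decide (T ∈ P (fun _ => false))) : ℝ)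

/-- item stmt-QuantumAdvantage-17598 · crux · rank 4 · open · by planner
why it might fail: Needs a perfectly-sound-CERTIFIED obfuscated encoding of twisted PS_ap pairs leaking no more than oracle access: VGB/strong-iO for this algebraic class + 1-message no-setup perfectly sound strong WI (open: Khurana2021 NIDI = arguments; LMS24: 2 rounds); the frame may leak t from ANY small circuits.
sources: AaronsonChen2017, BitanskyPanethRosen2015, doi:10.1109/FOCS.2015.94, KuykendallZhandry2020, Khurana2021, LouManoharSahai2024
[crux] WHITE-BOX ≤ BLACK-BOX + negl (hypothesis-type piece of the real/ideal redirect of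
HiddenSpreadWitness; AC17 §8's 'one unrelativised ingredient'). There is a certified hidden-spread
generator — the SAME S ∈ P, π ∈ FP, dec structure clause as HiddenSpreadWitness, ensembles D₀ (mask
0) / D₁ (mask ≠ 0) supported on S with field degree mdeg n ≥ n at level n — such that for every PPT
A there are a polynomially bounded query budget q_A, and a negligible ε_A with: for all n and δ, IF
every decision tree of depth ≤ q_A(n) has ideal mask-advantage ≤ δ (the SpreadIdealQueryBound
functional at m = mdeg n) THEN |Pr[A(1ⁿ, D₀ n)] − Pr[A(1ⁿ, D₁ n)]| ≤ δ + ε_A(n). Holds VACUOUSLY in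
worlds where twisted spreads are black-box easy (δ forced large), so it gives neither
HiddenSpreadWitness nor the summit on its own. Skeleton: oracle machine = mixture of trees (pure) +
HSF⁺ at ORACLE level (PRP-keyed b, pseudorandom frame, obfuscation + perfectly sound one-message
certificate, computational PRP hop for PPT oracle machines). WHY IT MIGHT FAIL: Needs a
perfectly-sound-CERTIFIED obfuscated encoding of twisted PS_ap pairs leaking no more than oracle
access: VGB/strong-iO for this algebraic class + 1 -/
@[route_item "route-QuantumAdvantage-HiddenSpread"]
def CertifiedSpreadLeakage : Prop :=
  ∃ S : Set (List Bool), S ∈ Literature.Computability.Complexity.Classes.P ∧ ∃ π : List Bool → List Bool, π ∈ Literature.Computability.Complexity.FP ∧ ∃ dec : List Bool → Σ m : ℕ, (Fin 2 → Literature.Computability.Complexity.Circuit (Fin (2 * m))) × (Fin (2 * m) → Bool), (∀ x ∈ S, 2 ≤ (dec x).1 ∧ (∀ i, ((dec x).2.1 i).IsOver Literature.Computability.Complexity.B2) ∧ π x = (⟨2 * (dec x).1, 2, (dec x).2.1⟩ : Literature.Computability.QuantumComplexity.KForrelationInstance).encode ∧ (let m := (dec x).1; (∃ (b : GaloisField 2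 m → Bool) (e : (GaloisField 2 m × GaloisField 2 m) ≃ₗ[ZMod 2] (Fin (2 * m) → ZMod 2)) (g : (Fin (2 * m) → Bool) → Bool), (Nat.card {a : GaloisField 2 m // b a = true} = 2 ^ (m - 1) ∧ b 0 = false) ∧ (∀ u : Fin (2 * m) → Bool, ∑ w : Fin (2 * m) → Bool, Literature.Computability.QuantumComplexity.signOf ((fun w : Fin (2 * m) → Bool => b ((e.symm (fun i => if w i then (1 : ZMod 2) else 0)).1 * (e.symm (fun i => if w i then (1 : ZMod 2) else 0)).2 ^ (2 ^ m - 2))) w) * Literature.Computability.QuantumComplexity.twist u w = (2 : ℝ) ^ m * Literature.Computability.QuantumComplexity.signOf (g u)) ∧ ((dec x).2.1 0).eval = (fun w : Fin (2 * m) → Bool => b ((e.symm (fun i => if w i then (1 : ZMod 2) else 0)).1 * (e.symm (fun i => if w i then (1 : ZMod 2) else 0)).2 ^ (2 ^ m - 2))) ∧ ((dec x).2.1 1).eval = (fun u : Fin (2 * m) → Bool => xor (g u) (Nat.bodd (Finset.univ.filter fun i => (dec x).2.2 i && u i).card))))) ∧ ∃ (mdeg : ℕ → ℕ) (D₀ D₁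 : ℕ → PMF (List Bool)), (∀ n, n ≤ mdeg n) ∧ (∀ n, ∀ x ∈ (D₀ n).support, x ∈ S ∧ (dec x).2.2 = (fun _ => false) ∧ (dec x).1 = mdeg n) ∧ (∀ n, ∀ x ∈ (D₁ n).support, x ∈ S ∧ (dec x).2.2 ≠ (fun _ => false) ∧ (dec x).1 = mdeg n) ∧ ∀ A : Literature.Computability.Complexity.RandAlg (List Bool) Bool, A.IsPolyTime id Computability.encodeBool → ∃ (q : ℕ → ℕ) (k : ℕ) (ε : ℕ → ℝ), (∀ n, q n ≤ n ^ k + k) ∧ Asymptotics.SuperpolynomialDecay Filter.atTop (fun n : ℕ => (n : ℝ)) ε ∧ ∀ (n : ℕ) (δ : ℝ), (∀ (ι : Bool × (Fin (2 * (mdeg n)) → Bool) ≃ Fin (2 * 2 ^ (2 * (mdeg n)))) (T : Literature.Computability.Complexity.DecisionTree (2 * 2 ^ (2 * (mdeg n)))), T.depth ≤ q n → (let wt : ((Fin (2 * (mdeg n)) → Bool) → Prop) → (Fin (2 * 2 ^ (2 * (mdeg n))) → Bool) → ℝ := fun M tbl => (Nat.card {σ : (GaloisField 2 (mdeg n) →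 Bool) × ((GaloisField 2 (mdeg n) × GaloisField 2 (mdeg n)) ≃ₗ[ZMod 2] (Fin (2 * (mdeg n)) → ZMod 2)) × ((Fin (2 * (mdeg n)) → Bool) → Bool) × (Fin (2 * (mdeg n)) → Bool) // ((Nat.card {a : GaloisField 2 (mdeg n) // σ.1 a = true} = 2 ^ ((mdeg n) - 1) ∧ σ.1 0 = false) ∧ (∀ u : Fin (2 * (mdeg n)) → Bool, ∑ w : Fin (2 * (mdeg n)) → Bool, Literature.Computability.QuantumComplexity.signOf ((fun w : Fin (2 * (mdeg n)) → Bool => σ.1 ((σ.2.1.symm (fun i => if w i then (1 : ZMod 2) else 0)).1 * (σ.2.1.symm (fun i => if w i then (1 : ZMod 2) else 0)).2 ^ (2 ^ (mdeg n) - 2))) w) * Literature.Computability.QuantumComplexity.twist u w = (2 : ℝ) ^ (mdeg n) * Literature.Computability.QuantumComplexity.signOf (σ.2.2.1 u))) ∧ M σ.2.2.2 ∧ tbl = (fun k : Fin (2 * 2 ^ (2 * (mdeg n))) => if (ι.symm k).1 then xor (σ.2.2.1 (ι.symm k).2) (Nat.bodd (Finset.univ.filter fun i => σ.2.2.2 i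 && (ι.symm k).2 i).card) else σ.1 ((σ.2.1.symm (fun i => if (ι.symm k).2 i then (1 : ZMod 2) else 0)).1 * (σ.2.1.symm (fun i => if (ι.symm k).2 i then (1 : ZMod 2) else 0)).2 ^ (2 ^ (mdeg n) - 2)))} : ℝ); let acc : ((Fin (2 * (mdeg n)) → Bool) → Prop) → ℝ := fun M => (∑ tbl : Fin (2 * 2 ^ (2 * (mdeg n))) → Bool, wt M tbl * (if T.eval tbl = true then (1 : ℝ) else 0)) / (∑ tbl : Fin (2 * 2 ^ (2 * (mdeg n))) → Bool, wt M tbl); |acc (fun t => t = fun _ => false) - acc (fun t => t ≠ fun _ => false)| ≤ δ)) → |(((D₀ n).bind fun s => A.outputPMF id (Literature.Computability.Complexity.boolPair (Computability.unaryEncodeNat n) s)) true).toReal - (((D₁ n).bind fun s => A.outputPMF id (Literature.Computability.Complexity.boolPair (Computability.unaryEncodeNat n) s)) true).toReal| ≤ δ + ε n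

-- item stmt-QuantumAdvantage-2638 · support · rank 4 · open · by planner — informal only, no Lean statement yet:
--   [crux] ObfuscatedSpreadInstantiation (informal until the definitions IndistinguishabilityObfuscator
--   and OneMessageProofSystem land; CONDITIONAL INSTANTIATION of HiddenSpreadWitness). Data: a
--   pseudorandom PERMUTATION family P on m bits (tree PseudorandomPermutations; classical PPT security
--   suffices), b_k := bit₁∘P_k ⊕ bit₁(P_k 0) (exactly balanced, b_k 0 = 0); a uniformly random 𝔽₂-linear
--   equivalence e : 𝔽_{2^m}² ≃ 𝔽₂^{2m} (part of the key); F_{k,e} := twisted PS_ap function of b_k,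
--   G_{k,e,t} := (its Walsh dual, of twisted PS_ap form by SpreadDuality) ⊕ ⟨t,·⟩ — both poly(m)-size
--   B₂-circuits; a

/-- item stmt-QuantumAdvantage-17612 · support · rank 9 · open · by planner
[support] [glue] PROVED sorry-free (crux-strategist 2026-08-17; candidate proof attached as evidence
= Cruxes/HiddenSpreadWitness/Split.lean, theorem
Summit.QuantumAdvantage.QuantumAdvantage.Theorems.HiddenSpreadWitness.Split.HiddenSpreadWitness_of_subs,
farm rc0, axioms propext/Classical.choice/Quot.sound; a prover lands it verbatim as `theorem … :
HiddenSpreadWitnessOfSplit := fun h₁ h₂ => …`). The real/ideal decomposition of the deciding crux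
HiddenSpreadWitness (AaronsonChen2017 Thm 7.6/§8 seam): the IDEAL black-box tree bound
SpreadIdealQueryBound and the WHITE-BOX leakage hypothesis CertifiedSpreadLeakage together give X —
keep S, π, dec, D₀, D₁ from the leakage witness; per PPT A feed its (q, k, ε) the ideal bound δ_n :=
c (q n + 1)²/√2^{mdeg n} (mdeg n ≥ 2 from a certified support point), so the white-box gap is ≤ c
(nᵏ+k+1)² (1/√2)ⁿ + ε n, negligible (SuperpolynomialDecay.polynomial_mul +
tendsto_pow_const_mul_const_pow_of_abs_lt_one). Once landed, the tenure planner can record the split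
formally: ledger route edit route-QuantumAdvantage-HiddenSpread --split HiddenSpreadWitness …
--glue-by <landed theorem> (the strategist seat's --split bounced on the final-cycle-only rule -/
@[route_item "route-QuantumAdvantage-HiddenSpread"]
def HiddenSpreadWitnessOfSplit : Prop :=
  SpreadIdealQueryBound → CertifiedSpreadLeakage → HiddenSpreadWitness

/-- item stmt-QuantumAdvantage-2455 · support · rank 9 · open · by planner
sources: DuttaMaitraMukherjee2022, arXiv:2104.12212, AaronsonAmbainis2018
Known (DuttaMaitraMukherjee2022 §3 Prop 1–3; 3-line character sum): if g is the Walsh dual of f on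
2m bits (∑_w (−1)^{f w+u·w} = 2^m(−1)^{g u} for all u) then the tree's 2-fold forrelation value of
(f, g ⊕ ⟨t,·⟩) is EXACTLY 1 for t = 0 and EXACTLY 0 for t ≠ 0 (∑_u (−1)^{t·u} = 2^{2m}[t=0]).
Load-bearing in the Assembly: certified instances are yes (Φ = 1 ≥ 3/5) or no (|Φ| = 0 ≤ 1/100)
instances of `kForrelationProblem`, and P 0 ∩ P t = ∅. Verified numerically (planner
py/check_duality.py, m = 2, 3). [DuttaMaitraMukherjee2022 Prop 1-3; AaronsonAmbainis2018 §1.1.1] -/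
@[route_item "route-QuantumAdvantage-HiddenSpread", crux]
def ExactForrelation : Prop :=
  ∀ (m : ℕ) (f g : (Fin (2 * m) → Bool) → Bool) (t : Fin (2 * m) → Bool), (∀ u : Fin (2 * m) → Bool, ∑ w : Fin (2 * m) → Bool, Literature.Computability.QuantumComplexity.signOf (f w) * Literature.Computability.QuantumComplexity.twist u w = (2 : ℝ) ^ m * Literature.Computability.QuantumComplexity.signOf (g u)) → Literature.Computability.QuantumComplexity.kForrelationValue ![f, (fun u : Fin (2 * m) → Bool => xor (g u) (Nat.bodd (Finset.univ.filter fun i => t i && u i).card))] = if t = (fun _ => false) then 1 else 0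

/-- item stmt-QuantumAdvantage-2456 · support · rank 9 · open · by planner
sources: Dillon1974, Roetteler2010, Carlet2010
Dillon's theorem through a twist (Dillon1974; Roetteler2010 Thm 5; Carlet2010 §8.6): for m ≥ 2, b
balanced on 𝔽_{2^m} with b 0 = 0 and any 𝔽₂-linear equivalence e : 𝔽_{2^m}² ≃ 𝔽₂^{2m}, the function
w ↦ b((e⁻¹w).1·(e⁻¹w).2^{2^m−2}) (= b(x/y), constant on the elements of a Desarguesian spread) is
bent and its dot-product Walsh dual is again of twisted PS_ap form with the SAME b and swapped
coordinates, u ↦ b((d⁻¹u).2·(d⁻¹u).1^{2^m−2}) for some linear equivalence d (d⁻¹ = adjoint of e for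
the trace form Tr(xx'+yy') vs the dot product; E_a = {(ay,y)} has E_a^⟂ = {(u,au)}). Gives: the
hidden-spread family is nonempty and BOTH members of a pair have poly(m)-size circuits given
(b-circuit, e) — the white-box ingredient Forrelation lacked (efficiently computable sgn f̂).
Verified numerically for m = 2, 3 (py/check_duality.py). [Dillon1974; Roetteler2010 Thm 5;
Carlet2010] -/
@[route_item "route-QuantumAdvantage-HiddenSpread"]
def SpreadDuality : Prop :=
  ∀ (m : ℕ), 2 ≤ m → ∀ (b : GaloisField 2 m → Bool), (Nat.card {a : GaloisField 2 m // b a = true} = 2 ^ (m - 1) ∧ b 0 = false) → ∀ e : (GaloisField 2 m × GaloisField 2 m) ≃ₗ[ZMod 2] (Fin (2 * m) → ZMod 2), ∃ d : (GaloisField 2 m × GaloisField 2 m) ≃ₗ[ZMod 2] (Fin (2 * m) → ZMod 2), (∀ u : Fin (2 * m) → Bool, ∑ w : Fin (2 * m) → Bool, Literature.Computability.QuantumComplexity.signOf ((fun w : Fin (2 * m) → Bool => b ((e.symm (fun i => if w i then (1 : ZMod 2) else 0)).1 * (e.symm (fun i => if w i then (1 : ZMod 2) else 0)).2 ^ (2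 ^ m - 2))) w) * Literature.Computability.QuantumComplexity.twist u w = (2 : ℝ) ^ m * Literature.Computability.QuantumComplexity.signOf ((fun u : Fin (2 * m) → Bool => b ((d.symm (fun i => if u i then (1 : ZMod 2) else 0)).2 * (d.symm (fun i => if u i then (1 : ZMod 2) else 0)).1 ^ (2 ^ m - 2))) u))

/-- item stmt-QuantumAdvantage-2457 · support · rank 9 · open · by planner
sources: AaronsonAmbainis2018, Watrous2009
The certification bridge (glue over PROVED cone facts): if S ∈ P and π ∈ FP map every x ∈ S into the
promise (yes ∪ no) of the tree's explicit k-fold Forrelation problem, then L = {x ∈ S | π x ∈ yes}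
is a BQP LANGUAGE. Proof: r x := if x ∈ S then π x else x₀ (a fixed no-instance, e.g. n = k = 1 with
the identity circuit, Φ = 0) is in FP and Karp-reduces ofLanguage L to kForrelationProblem
(complement handled by kForrelationProblem_disjoint); conclude with
AaronsonAmbainis2018_kForrelation_mem_holds (PROVED),
Cryptography.mem_PromiseBQP_of_polyTimeReducible (PROVED) and ofLanguage_mem_PromiseBQP_iff
(PROVED). This is what lets the route bypass the open promise→language lift PlLift of route
PromiseLift: certification replaces the promise. [AaronsonAmbainis2018 §6 Prop 6; Watrous2009
§III.2; GoldreichPromise2006] -/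
@[route_item "route-QuantumAdvantage-HiddenSpread", crux]
def CertifiedForrelationInBQP : Prop :=
  ∀ S : Set (List Bool), S ∈ Literature.Computability.Complexity.Classes.P → ∀ π : List Bool → List Bool, π ∈ Literature.Computability.Complexity.FP → (∀ x ∈ S, π x ∈ Literature.Computability.QuantumComplexity.kForrelationProblem.yes ∨ π x ∈ Literature.Computability.QuantumComplexity.kForrelationProblem.no) → {x | x ∈ S ∧ π x ∈ Literature.Computability.QuantumComplexity.kForrelationProblem.yes} ∈ Literature.Computability.Cryptography.BQP

/-- item stmt-QuantumAdvantage-2458 · support · rank 9 · open · by planner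
sources: Goldreich2001, AroraBarak2009
Glue over the PROVED Gill form mem_BPP_iff_randAlg_holds: if D₀ is supported inside L, D₁ inside Lᶜ
(at every index n) and the ensembles are computationally indistinguishable (negligible advantage for
every PPT distinguisher on (1ⁿ, s)), then L ∉ BPP — a BPP machine for L, wrapped as a RandAlg
reading s out of boolPair (1ⁿ) s (coin budget q(|input|) ≥ q(|s|)), accepts D₀-samples with
probability ≥ 2/3 and D₁-samples with probability ≤ 1/3: advantage ≥ 1/3 at every n, not negligible.
[Goldreich2001 Def 3.2.2; Gill1977; AroraBarak2009 Def 7.3] -/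
@[route_item "route-QuantumAdvantage-HiddenSpread", crux]
def IndistinguishableNotInBPP : Prop :=
  ∀ (L : Language Bool) (D₀ D₁ : ℕ → PMF (List Bool)), (∀ n, ∀ x ∈ (D₀ n).support, x ∈ L) → (∀ n, ∀ x ∈ (D₁ n).support, x ∉ L) → (∀ A : Literature.Computability.Complexity.RandAlg (List Bool) Bool, A.IsPolyTime id Computability.encodeBool → Asymptotics.SuperpolynomialDecay Filter.atTop (fun n : ℕ => (n : ℝ)) (fun n : ℕ => |(((D₀ n).bind fun s => A.outputPMF id (Literature.Computability.Complexity.boolPair (Computability.unaryEncodeNat n) s)) true).toReal - (((D₁ n).bind fun s => A.outputPMF id (Literature.Computability.Complexity.boolPair (Computability.unaryEncodeNat n) s)) true).toReal|)) → L ∉ Literature.Computability.Complexity.BPP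

/-- item stmt-QuantumAdvantage-2459 · assembly · rank 1 · open · by planner
sources: AaronsonAmbainis2018, Roetteler2010
X → Statement: from HiddenSpreadWitness take S, π, dec, D₀, D₁ and put L := {x ∈ S | π x ∈
kForrelationProblem.yes}. For x ∈ S, π x encodes ⟨2m, 2, C⟩ over B₂ with (C 0).eval = f, (C 1).eval
= g ⊕ ⟨t,·⟩, so by ExactForrelation its value is [t = 0] ∈ {0,1}: yes or no instance —
CertifiedForrelationInBQP gives L ∈ BQP; D₀-samples (t = 0, Φ = 1) lie in L, D₁-samples (t ≠ 0, Φ =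
0, and yes ∩ no = ∅ by kForrelationProblem_disjoint) lie in Lᶜ, so IndistinguishableNotInBPP gives L
∉ BPP; hence ∃ L ∈ BQP ∧ L ∉ BPP = Literature.QuantumAdvantage.BQPNotSubsetBPP = QuantumAdvantage. -/
@[route_item "route-QuantumAdvantage-HiddenSpread"]
def Assembly : Prop :=
  CertifiedForrelationInBQP → IndistinguishableNotInBPP → ExactForrelation → HiddenSpreadWitness → QuantumAdvantage

/-! D-0027 §2.1 — DECIDING THEOREM (planner-authored via `route open/edit --closes-file`; by planner-rbadge-QuantumAdvantage-HiddenSpread-5c22d9d0-g4-0 2026-08-15T16:18:16Z):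
its hypotheses are this route's items and its conclusion the sub-problem Statement (glue_lint), and it elaborates with this file. -/

@[closes "route-QuantumAdvantage-HiddenSpread"] theorem closes (hW : HiddenSpreadWitness) (hE : ExactForrelation) (hC : CertifiedForrelationInBQP)
    (hI : IndistinguishableNotInBPP) : QuantumAdvantage := by
  classical
  obtain ⟨S, hS, π, hπ, dec, hx, D₀, D₁, hind, hD₀, hD₁⟩ := hW
  -- the certified instance carried by `x ∈ S` is a yes-instance when the mask vanishes …
  have hyes : ∀ x ∈ S, (dec x).2.2 = (fun _ => false) →
      π x ∈ Literature.Computability.QuantumComplexity.kForrelationProblem.yes := by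
    intro x hxS ht
    obtain ⟨_, hB2, hπx, b, e, g, _, hdual, hC0, hC1⟩ := hx x hxS
    have hv := hE (dec x).1 _ g (dec x).2.2 hdual
    rw [if_pos ht] at hv
    rw [hπx, Literature.Computability.QuantumComplexity.encode_mem_kForrelationProblem_yes_iff]
    refine ⟨hB2, ?_⟩
    have hval : Literature.Computability.QuantumComplexity.KForrelationInstance.value
        ⟨2 * (dec x).1, 2, (dec x).2.1⟩ = 1 := by
      rw [← hv]
      unfold Literature.Computability.QuantumComplexity.KForrelationInstance.value
      congr 1
      funext i
      fin_cases i
      · simpa using hC0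
      · simpa using hC1
    rw [hval]
    norm_num
  -- … and a no-instance otherwise
  have hno : ∀ x ∈ S, (dec x).2.2 ≠ (fun _ => false) →
      π x ∈ Literature.Computability.QuantumComplexity.kForrelationProblem.no := by
    intro x hxS ht
    obtain ⟨_, hB2, hπx, b, e, g, _, hdual, hC0, hC1⟩ := hx x hxS
    have hv := hE (dec x).1 _ g (dec x).2.2 hdual
    rw [if_neg ht] at hv
    rw [hπx, Literature.Computability.QuantumComplexity.encode_mem_kForrelationProblem_no_iff]
    refine ⟨hB2, ?_⟩
    have hval : Literature.Computability.QuantumComplexity.KForrelationInstance.value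
        ⟨2 * (dec x).1, 2, (dec x).2.1⟩ = 0 := by
      rw [← hv]
      unfold Literature.Computability.QuantumComplexity.KForrelationInstance.value
      congr 1
      funext i
      fin_cases i
      · simpa using hC0
      · simpa using hC1
    rw [hval]
    norm_num
  have hcert : ∀ x ∈ S, π x ∈ Literature.Computability.QuantumComplexity.kForrelationProblem.yes ∨
      π x ∈ Literature.Computability.QuantumComplexity.kForrelationProblem.no := fun x hxS =>
    (em ((dec x).2.2 = fun _ => false)).imp (hyes x hxS) (hno x hxS)
  refine ⟨{x | x ∈ S ∧ π x ∈ Literature.Computability.QuantumComplexity.kForrelationProblem.yes},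
    hC S hS π hπ hcert, hI _ D₀ D₁ ?_ ?_ hind⟩
  · intro n x hxD
    obtain ⟨hxS, ht⟩ := hD₀ n x hxD
    exact ⟨hxS, hyes x hxS ht⟩
  · rintro n x hxD ⟨hxS, hy⟩
    obtain ⟨-, ht⟩ := hD₁ n x hxD
    have hn := hno x hxS ht
    obtain ⟨I, hIyes, hIx⟩ :
        π x ∈ Literature.Computability.QuantumComplexity.KForrelationInstance.encode ''
          {I | I.IsYes} := hy
    rw [← hIx, Literature.Computability.QuantumComplexity.encode_mem_kForrelationProblem_no_iff] at hn
    exact Literature.Computability.QuantumComplexity.KForrelationInstance.not_isNo_of_isYes hIyes hn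

end Summit.QuantumAdvantage.QuantumAdvantage.Theses.HiddenSpread
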